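import Literature.NumberTheory.LFunctions.SiegelMordellIntegral
import Literature.Analysis.Complex.HolomorphicParametricIntegral
import Mathlib.Analysis.SpecialFunctions.Pow.Deriv
import Mathlib.Analysis.SpecialFunctions.Pow.Continuity
import Mathlib.MeasureTheory.Measure.Lebesgue.Integral
import HarnessLib

/-!
# Riemann's auxiliary function `𝓡(s) = ∫_{0↙1} x^{-s}e^{πix²}/(e^{πix} − e^{−πix}) dx` (Siegel 1932, §3)

Topic `Literature/NumberTheory/LFunctions`. Second file of the proof of the Riemann–Siegel integral
formula and of Lehman's bound (`Literature.NumberTheory.LFunctions.Trudgian2011_lemma_2_5`). Here: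
Siegel's integrand `F_s(x) = x^{-s} e^{πix²}/(e^{πix} − e^{−πix})`
(`Literature.NumberTheory.LFunctions.SiegelIntegral.rsKernel`), its integrals
`J_c(s) = ∫_{c↙} F_s` over the lines of slope one through real points `c`
(`Literature.NumberTheory.LFunctions.SiegelIntegral.rsLineIntegral`, parametrised by `x = c + u(1+i)`),
and Riemann's auxiliary function `𝓡(s) = J_{1/2}(s)`
(`Literature.NumberTheory.LFunctions.SiegelIntegral.riemannAux`; Siegel's `𝔣(s)`, eq. (58)). Proved:

* Gaussian majorants and integrability of `F_s` along the lines through non-integer `c > 0`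
  (`integrable_rsKernel_line`, `decay_rsKernel`), with the polynomial bound
  `‖x^{-s}‖ ≤ (|c|+2/|c|+2)^N (1+|u|)^N e^{π|t|}` (`norm_cpow_neg_line_le`);
* independence of the line (`rsLineIntegral_eq_of_noInt`, pole-free shift);
* for `σ < −1`: the line may be pushed onto the origin (`rsLineIntegral_eq_zero_line`: the kernel is
  continuous at `0`, where it is `O(‖z‖^{−σ−1})`), and the line through `0` splits into two rays,
  `∫_ℝ F_s(u(1+i)) du = (1 − e^{πis}) ∫_0^∞ F_s(u(1+i)) du` (`integral_rsKernel_line_zero`, from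
  `F_s(−x) = −e^{πis}F_s(x)`);
* `𝓡` and all `J_c` are entire (`differentiable_rsLineIntegral`, `differentiable_riemannAux`:
  holomorphic dependence of dominated parameter integrals).

## References

* C. L. Siegel, *Über Riemanns Nachlaß zur analytischen Zahlentheorie* (1932), §3. [Siegel1932]
* E. C. Titchmarsh, *The Theory of the Riemann Zeta-Function*, 2nd ed., §2.10. [Titchmarsh1986]
-/

noncomputable section

open Complex MeasureTheory Set Filter Real
open scoped Topology ComplexConjugate

namespace Literature.NumberTheory.LFunctions

namespace SiegelIntegral

/-! ## Complex powers along a line of slope one -/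

/-- `‖x^{-s}‖ = ‖x‖^{-σ} e^{t·arg x}` for `x ≠ 0` (`s = σ + it`). [folklore] -/
lemma norm_cpow_neg {x : ℂ} (hx : x ≠ 0) (s : ℂ) :
    ‖x ^ (-s)‖ = ‖x‖ ^ (-s.re) * Real.exp (s.im * arg x) := by
  rw [Complex.norm_cpow_of_ne_zero hx, neg_re, neg_im, div_eq_mul_inv, ← Real.exp_neg]
  congr 1
  ring_nf

/-- `‖x^{-s}‖ ≤ ‖x‖^{-σ} e^{π|t|}` for `x ≠ 0`. [folklore] -/
lemma norm_cpow_neg_le {x : ℂ} (hx : x ≠ 0) (s : ℂ) :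
    ‖x ^ (-s)‖ ≤ ‖x‖ ^ (-s.re) * Real.exp (π * |s.im|) := by
  rw [norm_cpow_neg hx]
  refine mul_le_mul_of_nonneg_left (Real.exp_le_exp.2 ?_) (Real.rpow_nonneg (norm_nonneg _) _)
  calc s.im * arg x ≤ |s.im * arg x| := le_abs_self _
    _ = |s.im| * |arg x| := abs_mul _ _
    _ ≤ |s.im| * π := mul_le_mul_of_nonneg_left (abs_arg_le_pi x) (abs_nonneg _)
    _ = π * |s.im| := mul_comm _ _

/-- `a^{-σ} ≤ (max a a⁻¹)^N` for `a > 0` and `|σ| ≤ N`. [folklore] -/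
lemma rpow_neg_le_max_pow {a : ℝ} (ha : 0 < a) {σ : ℝ} {N : ℕ} (hN : |σ| ≤ N) :
    a ^ (-σ) ≤ max a a⁻¹ ^ N := by
  set M := max a a⁻¹ with hM
  have hM1 : 1 ≤ M := by
    rcases le_or_gt 1 a with h | h
    · exact h.trans (le_max_left _ _)
    · exact ((one_le_inv₀ ha).2 h.le).trans (le_max_right _ _)
  have step1 : a ^ (-σ) ≤ M ^ |σ| := by
    rcases le_or_gt 0 σ with hs | hs
    · rw [abs_of_nonneg hs, Real.rpow_neg ha.le, ← Real.inv_rpow ha.le]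
      exact Real.rpow_le_rpow (inv_nonneg.2 ha.le) (le_max_right _ _) hs
    · rw [abs_of_neg hs]
      exact Real.rpow_le_rpow ha.le (le_max_left _ _) (by linarith)
  calc a ^ (-σ) ≤ M ^ |σ| := step1
    _ ≤ M ^ (N : ℝ) := Real.rpow_le_rpow_of_exponent_le hM1 hN
    _ = M ^ N := Real.rpow_natCast M N

/-- A point of the line through `c ≠ 0` is non-zero. [folklore] -/
lemma line_ne_zero {c : ℝ} (hc : c ≠ 0) (u : ℝ) : line c u ≠ 0 := by
  intro h
  have h1 := half_sq_le_sq_norm_line c u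
  rw [h, norm_zero] at h1
  have : 0 < c ^ 2 := by positivity
  nlinarith

/-- On the line through `c ≠ 0`: `max ‖x‖ ‖x‖⁻¹ ≤ (|c| + 2/|c| + 2)(1 + |u|)`. [folklore] -/
lemma max_norm_line_le {c : ℝ} (hc : c ≠ 0) (u : ℝ) :
    max ‖line c u‖ ‖line c u‖⁻¹ ≤ (|c| + 2 / |c| + 2) * (1 + |u|) := by
  have hc0 : 0 < |c| := abs_pos.2 hc
  have h1 : ‖line c u‖ ≤ |c| + 2 * |u| := norm_line_le c u
  have hsq := half_sq_le_sq_norm_line c u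
  have hx : |c| / 2 ≤ ‖line c u‖ := by
    have h4 : (|c| / 2) ^ 2 ≤ ‖line c u‖ ^ 2 := by
      rw [div_pow, sq_abs]; nlinarith [sq_nonneg c]
    have h5 := Real.sqrt_le_sqrt h4
    rwa [Real.sqrt_sq (by positivity), Real.sqrt_sq (norm_nonneg _)] at h5
  have hxpos : 0 < ‖line c u‖ := lt_of_lt_of_le (by positivity) hx
  have h2 : ‖line c u‖⁻¹ ≤ 2 / |c| := by
    rw [show (2 : ℝ) / |c| = (|c| / 2)⁻¹ by rw [inv_div]]
    exact (inv_le_inv₀ hxpos (by positivity)).2 hx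
  have hu := abs_nonneg u
  refine max_le ?_ ?_
  · nlinarith [div_nonneg (zero_le_two) hc0.le]
  · have : 0 ≤ (|c| + 2 / |c| + 2) * |u| := by positivity
    nlinarith [div_nonneg (zero_le_two) hc0.le]

/-- **Polynomial bound for `x^{-s}` along the line through `c ≠ 0`**:
`‖x^{-s}‖ ≤ (|c| + 2/|c| + 2)^N (1+|u|)^N e^{π|t|}` whenever `|σ| ≤ N`. [folklore] -/
lemma norm_cpow_neg_line_le {c : ℝ} (hc : c ≠ 0) (u : ℝ) (s : ℂ) {N : ℕ} (hN : |s.re| ≤ N) :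
    ‖(line c u) ^ (-s)‖ ≤ (|c| + 2 / |c| + 2) ^ N * (1 + |u|) ^ N * Real.exp (π * |s.im|) := by
  have hx : line c u ≠ 0 := line_ne_zero hc u
  have hxpos : 0 < ‖line c u‖ := norm_pos_iff.2 hx
  have h1 := norm_cpow_neg_le hx s
  have h2 := rpow_neg_le_max_pow hxpos hN
  have h3 : max ‖line c u‖ ‖line c u‖⁻¹ ^ N ≤ ((|c| + 2 / |c| + 2) * (1 + |u|)) ^ N :=
    pow_le_pow_left₀ (le_trans (norm_nonneg _) (le_max_left _ _)) (max_norm_line_le hc u) N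
  rw [mul_pow] at h3
  calc ‖(line c u) ^ (-s)‖ ≤ ‖line c u‖ ^ (-s.re) * Real.exp (π * |s.im|) := h1
    _ ≤ (|c| + 2 / |c| + 2) ^ N * (1 + |u|) ^ N * Real.exp (π * |s.im|) :=
        mul_le_mul_of_nonneg_right (h2.trans h3) (Real.exp_pos _).le

/-- The line through `c > 0` lies in the slit plane (off the negative real axis). [folklore] -/
lemma line_mem_slitPlane {c : ℝ} (hc : 0 < c) (u : ℝ) : line c u ∈ slitPlane := by
  rw [Complex.mem_slitPlane_iff, line_re, line_im]
  by_cases hu : u = 0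
  · left; rw [hu]; linarith
  · right; exact hu

/-- Points `z` with `re z − im z > 0` (or `≥ 0` and `z ≠ 0`) are in the slit plane. [folklore] -/
lemma mem_slitPlane_of_re_sub_im {z : ℂ} (h : 0 ≤ z.re - z.im) (hz : z ≠ 0) : z ∈ slitPlane := by
  rw [Complex.mem_slitPlane_iff]
  by_cases him : z.im = 0
  · left
    have hre : z.re ≠ 0 := fun h0 ↦ hz (Complex.ext h0 him)
    rcases lt_or_gt_of_ne hre with h1 | h1
    · rw [him] at h; linarith
    · exact h1
  · right; exact him

/-- `u ↦ (c + u(1+i))^{-s}` is continuous for `c > 0`. [folklore] -/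
lemma continuous_cpow_neg_line {c : ℝ} (hc : 0 < c) (s : ℂ) :
    Continuous fun u : ℝ ↦ (line c u) ^ (-s) :=
  continuous_iff_continuousAt.2 fun u ↦
    (continuousAt_cpow_const (b := -s) (line_mem_slitPlane hc u)).comp
      (by fun_prop : Continuous fun u : ℝ ↦ line c u).continuousAt

/-- A polynomial times an off-centred Gaussian is integrable. [folklore] -/
lemma integrable_poly_mul_gaussian (N : ℕ) (β γ : ℝ) :
    Integrable fun u : ℝ ↦ (1 + |u|) ^ N * Real.exp (-2 * π * u ^ 2 + β * u + γ) := by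
  refine Integrable.mono' ((integrable_exp_neg_mul_sq Real.pi_pos).const_mul
    (Real.exp (γ + (N + |β|) ^ 2 / (2 * π)))) (by fun_prop : Continuous fun u : ℝ ↦
      (1 + |u|) ^ N * Real.exp (-2 * π * u ^ 2 + β * u + γ)).aestronglyMeasurable
    (Eventually.of_forall fun u ↦ ?_)
  rw [Real.norm_eq_abs, abs_of_nonneg (by positivity)]
  exact poly_mul_gaussian_le N β γ u

/-! ## Siegel's integrand `x^{-s} e^{πix²}/(e^{πix} − e^{−πix})` -/

/-- Siegel's integrand `F_s(x) = x^{-s} e^{πix²}/(e^{πix} − e^{−πix})` (principal branch of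
`x^{-s}`; the denominator is `2i sin(πx)`), the kernel of Riemann's auxiliary function
`𝓡(s) = ∫_{0↙1} F_s(x) dx`. [cite: Siegel1932, §3 eq. (58)] -/
def rsKernel (s x : ℂ) : ℂ := x ^ (-s) * cexp (π * I * x ^ 2) / (2 * I * Complex.sin (π * x))

/-- The kernel in the generic shape `g · e^{πix² + bx}/sin(πx)` (`g = x^{-s}/(2i)`, `b = 0`).
[folklore] -/
lemma rsKernel_eq (s x : ℂ) :
    rsKernel s x = (x ^ (-s) * (2 * I)⁻¹) * cexp (π * I * x ^ 2 + 0 * x) / Complex.sin (π * x) := by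
  rw [rsKernel, zero_mul, add_zero, ← div_div]
  congr 1
  ring

/-- The kernel vanishes at `x = 0` (Lean's junk values: `0^{-s} = 0` for `s ≠ 0`, and division by
`sin 0 = 0`). [folklore] -/
lemma rsKernel_zero (s : ℂ) : rsKernel s 0 = 0 := by
  simp [rsKernel]

/-- Differentiability of the kernel off the cut and off the integers. [folklore] -/
lemma differentiableAt_rsKernel (s : ℂ) {z : ℂ} (hz : z ∈ slitPlane)
    (hsin : Complex.sin (π * z) ≠ 0) : DifferentiableAt ℂ (rsKernel s) z := by
  have h1 : DifferentiableAt ℂ (fun x : ℂ ↦ x ^ (-s)) z := differentiableAt_id.cpow_const hz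
  have h2 : DifferentiableAt ℂ (fun x : ℂ ↦ x ^ (-s) * cexp (π * I * x ^ 2)) z :=
    h1.mul (by fun_prop)
  have h3 : DifferentiableAt ℂ (fun x : ℂ ↦ 2 * I * Complex.sin (π * x)) z := by fun_prop
  exact h2.div h3 (mul_ne_zero (mul_ne_zero two_ne_zero I_ne_zero) hsin)

/-- In a closed slanted strip `{c₁ ≤ re − im ≤ c₂}` containing no integer `n ∈ [c₁, c₂]` other
than possibly excluded ones, `sin(πz) = 0` forces `z` to be such an integer. [folklore] -/
lemma eq_int_of_sin_eq_zero {z : ℂ} (h0 : Complex.sin (π * z) = 0) :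
    ∃ n : ℤ, z = n ∧ z.re - z.im = n := by
  obtain ⟨n, hn⟩ := (Literature.Analysis.Complex.sin_pi_mul_eq_zero_iff z).1 h0
  exact ⟨n, hn, by rw [hn]; simp⟩

/-- Continuity of `u ↦ F_s(c + u(1+i))` for `c > 0` non-integer. [folklore] -/
lemma continuous_rsKernel_line (s : ℂ) {c : ℝ} (hc : 0 < c) (hcn : ∀ n : ℤ, (n : ℝ) ≠ c) :
    Continuous fun u : ℝ ↦ rsKernel s (line c u) := by
  refine continuous_iff_continuousAt.2 fun u ↦ ?_
  exact (differentiableAt_rsKernel s (line_mem_slitPlane hc u)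
    (sin_pi_line_ne_zero hcn u)).continuousAt.comp (by fun_prop : Continuous fun u : ℝ ↦ line c u).continuousAt

/-- Pointwise bound for the kernel along the line through `c > 0` at distance `≥ d` from `ℤ`:
`‖F_s(x)‖ ≤ (|c|+2/|c|+2)^N e^{π|t|}/(2d) · (1+|u|)^N e^{−2πu² − 2πcu}` (`|σ| ≤ N`). [folklore] -/
lemma norm_rsKernel_line_le {c d : ℝ} (hc : 0 < c) (hd0 : 0 < d) (hd : ∀ n : ℤ, d ≤ |c - n|)
    (u : ℝ) (s : ℂ) {N : ℕ} (hN : |s.re| ≤ N) :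
    ‖rsKernel s (line c u)‖ ≤ (|c| + 2 / |c| + 2) ^ N * Real.exp (π * |s.im|) / (2 * d) *
      ((1 + |u|) ^ N * Real.exp (-2 * π * u ^ 2 + (-2 * π * c) * u + 0)) := by
  rw [rsKernel_eq, norm_div, norm_mul, norm_cexp_quadPhase]
  have hs := le_norm_sin_pi_line hd u
  have hpow := norm_cpow_neg_line_le hc.ne' u s hN
  have hL : Real.exp (-2 * π * u ^ 2 - 2 * π * c * u + (0 : ℂ).re * (c + u) - (0 : ℂ).im * u)
      = Real.exp (-2 * π * u ^ 2 + -2 * π * c * u + 0) := by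
    congr 1; simp only [zero_re, zero_im]; ring
  rw [hL, div_le_iff₀ (hd0.trans_le hs), norm_mul, norm_inv, norm_mul, Complex.norm_two,
    Complex.norm_I, mul_one]
  set E := Real.exp (-2 * π * u ^ 2 + -2 * π * c * u + 0) with hE
  set A := (|c| + 2 / |c| + 2) ^ N with hA
  have hE0 : 0 < E := Real.exp_pos _
  calc ‖line c u ^ (-s)‖ * 2⁻¹ * E ≤ (A * (1 + |u|) ^ N * Real.exp (π * |s.im|)) * 2⁻¹ * E := by
        gcongr
    _ = A * Real.exp (π * |s.im|) / (2 * d) * ((1 + |u|) ^ N * E) * d := by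
        field_simp
    _ ≤ A * Real.exp (π * |s.im|) / (2 * d) * ((1 + |u|) ^ N * E) * ‖Complex.sin (↑π * line c u)‖ := by
        have : 0 ≤ A * Real.exp (π * |s.im|) / (2 * d) * ((1 + |u|) ^ N * E) := by positivity
        exact mul_le_mul_of_nonneg_left hs this

/-- **Integrability of Siegel's integrand along the line through a non-integer `c > 0`.**
[folklore] -/
theorem integrable_rsKernel_line (s : ℂ) {c d : ℝ} (hc : 0 < c) (hd0 : 0 < d)
    (hd : ∀ n : ℤ, d ≤ |c - n|) : Integrable fun u : ℝ ↦ rsKernel s (line c u) := by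
  set N : ℕ := ⌈|s.re|⌉₊ with hN
  have hN' : |s.re| ≤ N := Nat.le_ceil _
  have hcn : ∀ n : ℤ, (n : ℝ) ≠ c := fun n h ↦ by
    have := hd n; rw [← h, sub_self, abs_zero] at this; linarith
  refine Integrable.mono' ((integrable_poly_mul_gaussian N (-2 * π * c) 0).const_mul
    ((|c| + 2 / |c| + 2) ^ N * Real.exp (π * |s.im|) / (2 * d)))
    (continuous_rsKernel_line s hc hcn).aestronglyMeasurable
    (Eventually.of_forall fun u ↦ norm_rsKernel_line_le hc hd0 hd u s hN')

/-- A non-integer real keeps a positive distance from the integers. [folklore] -/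
lemma exists_pos_le_abs_sub_int {c : ℝ} (hcn : ∀ n : ℤ, (n : ℝ) ≠ c) :
    ∃ d : ℝ, 0 < d ∧ ∀ n : ℤ, d ≤ |c - n| := by
  refine ⟨min (Int.fract c) (1 - Int.fract c), ?_, fun n ↦ ?_⟩
  · have h1 : 0 < Int.fract c := Int.fract_pos.2 fun h ↦ hcn ⌊c⌋ h.symm
    have h3 : Int.fract c < 1 := Int.fract_lt_one c
    exact lt_min h1 (by linarith)
  · have hc : c = ⌊c⌋ + Int.fract c := (Int.floor_add_fract c).symm
    rcases le_or_gt n ⌊c⌋ with h | h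
    · have h' : (n : ℝ) ≤ ⌊c⌋ := by exact_mod_cast h
      rw [abs_of_nonneg (by linarith [Int.fract_nonneg c])]
      exact (min_le_left _ _).trans (by linarith)
    · have h' : (⌊c⌋ : ℝ) + 1 ≤ n := by exact_mod_cast h
      rw [abs_of_nonpos (by linarith [Int.fract_lt_one c])]
      exact (min_le_right _ _).trans (by linarith)

/-- **Uniform decay of Siegel's integrand on the far cross-sections**, for `c` ranging over a
compact interval `[c₁, c₂] ⊂ (0, ∞)`. [folklore] -/
theorem decay_rsKernel (s : ℂ) {c₁ c₂ : ℝ} (hc₁ : 0 < c₁) :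
    ∀ ε : ℝ, 0 < ε → ∃ T₀ : ℝ, ∀ T : ℝ, T₀ ≤ |T| → ∀ c ∈ Icc c₁ c₂,
      ‖rsKernel s (line c T)‖ ≤ ε := by
  set N : ℕ := ⌈|s.re|⌉₊ with hN
  have hN' : |s.re| ≤ N := Nat.le_ceil _
  set A : ℝ := c₂ + 2 / c₁ + 2 with hA
  have hG : ∀ c ∈ Icc c₁ c₂, ∀ T : ℝ, 1 ≤ |T| →
      ‖(line c T) ^ (-s) * (2 * I)⁻¹‖ ≤ (A ^ N * Real.exp (π * |s.im|) / 2) * (1 + |T|) ^ N := by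
    intro c hc T _
    have hc0 : 0 < c := hc₁.trans_le hc.1
    have hAc : |c| + 2 / |c| + 2 ≤ A := by
      rw [abs_of_pos hc0, hA]
      have : 2 / c ≤ 2 / c₁ := div_le_div_of_nonneg_left (by norm_num) hc₁ hc.1
      linarith [hc.2]
    have h := norm_cpow_neg_line_le hc0.ne' T s hN'
    rw [norm_mul, norm_inv, norm_mul, Complex.norm_two, Complex.norm_I, mul_one]
    have hAc' : (|c| + 2 / |c| + 2) ^ N ≤ A ^ N := pow_le_pow_left₀ (by positivity) hAc N
    calc ‖line c T ^ (-s)‖ * 2⁻¹ ≤ ((|c| + 2 / |c| + 2) ^ N * (1 + |T|) ^ N * Real.exp (π * |s.im|)) * 2⁻¹ := by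
          gcongr
      _ ≤ (A ^ N * (1 + |T|) ^ N * Real.exp (π * |s.im|)) * 2⁻¹ := by gcongr
      _ = A ^ N * Real.exp (π * |s.im|) / 2 * (1 + |T|) ^ N := by ring
  have h := decay_mul_cexp_quadPhase_div_sin (G := fun x : ℂ ↦ x ^ (-s) * (2 * I)⁻¹) hG 0
  intro ε hε
  obtain ⟨T₀, hT₀⟩ := h ε hε
  refine ⟨T₀, fun T hT c hc ↦ ?_⟩
  have h1 := hT₀ T hT c hc
  rwa [← rsKernel_eq] at h1

/-! ## The line integrals `∫_{c↙} F_s` and Riemann's auxiliary function -/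

/-- `J_c(s) = −(1+i) ∫ F_s(c + u(1+i)) du`: the integral of Siegel's integrand over the line of
slope one through the real point `c`, oriented from upper right to lower left (Siegel's
`∫_{c↙}`; `dx = (1+i)du` and the orientation give the factor `−(1+i)`). [cite: Siegel1932, §3 eq. (58)] -/
def rsLineIntegral (c : ℝ) (s : ℂ) : ℂ := -(1 + I) * ∫ u : ℝ, rsKernel s (line c u)

/-- **Riemann's auxiliary function** `𝓡(s) = ∫_{0↙1} x^{-s} e^{πix²}/(e^{πix} − e^{−πix}) dx`, the
line taken through `x = ½` (Siegel 1932, eq. (58): `𝔣(s)`; Arias de Reyna's `𝓡(s)`). It is entire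
(`Literature.NumberTheory.LFunctions.SiegelIntegral.differentiable_riemannAux`) and satisfies the
Riemann–Siegel integral formula `ζ(s) = 𝓡(s) + χ(s) conj 𝓡(1 − s̄)`. [cite: Siegel1932, §3 eq. (58)] -/
def riemannAux (s : ℂ) : ℂ := rsLineIntegral (1 / 2) s

/-- Unfolding `riemannAux`. [folklore] -/
lemma riemannAux_def (s : ℂ) : riemannAux s = -(1 + I) * ∫ u : ℝ, rsKernel s (line (1 / 2) u) := rfl

/-- **Independence of the line** (pole-free shift): if `[c₁, c₂] ⊂ (0,∞)` contains no integer,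
the integrals over the lines through `c₁` and `c₂` agree. [cite: Siegel1932, §1] -/
theorem rsLineIntegral_eq_of_noInt {c₁ c₂ : ℝ} (hc₁ : 0 < c₁) (h12 : c₁ ≤ c₂)
    (hnoint : ∀ n : ℤ, (n : ℝ) ∉ Icc c₁ c₂) (s : ℂ) :
    rsLineIntegral c₂ s = rsLineIntegral c₁ s := by
  -- no zeros of `sin(πz)` in the closed strip
  have hsin : ∀ z : ℂ, z.re - z.im ∈ Icc c₁ c₂ → Complex.sin (π * z) ≠ 0 := by
    intro z hz h0
    obtain ⟨n, -, hn⟩ := eq_int_of_sin_eq_zero h0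
    exact hnoint n (hn ▸ hz)
  have hdiff : ∀ z : ℂ, z.re - z.im ∈ Icc c₁ c₂ → DifferentiableAt ℂ (rsKernel s) z := fun z hz ↦
    differentiableAt_rsKernel s (mem_slitPlane_of_re_sub_im (by linarith [hz.1])
      (fun h0 ↦ by rw [h0] at hz; simp at hz; linarith [hz.1])) (hsin z hz)
  have hc₂ : 0 < c₂ := hc₁.trans_le h12
  have hcn : ∀ (c : ℝ), c ∈ Icc c₁ c₂ → ∀ n : ℤ, (n : ℝ) ≠ c := fun c hc n h ↦ hnoint n (h ▸ hc)
  obtain ⟨d₁, hd₁0, hd₁⟩ := exists_pos_le_abs_sub_int (hcn c₁ ⟨le_rfl, h12⟩)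
  obtain ⟨d₂, hd₂0, hd₂⟩ := exists_pos_le_abs_sub_int (hcn c₂ ⟨h12, le_rfl⟩)
  have h := Literature.Analysis.Complex.integral_slant_eq_of_continuousOn_of_differentiableOn
    (f := rsKernel s) h12 (fun z hz ↦ (hdiff z hz).continuousAt.continuousWithinAt)
    (fun z hz ↦ (hdiff z ⟨hz.1.le, hz.2.le⟩).differentiableWithinAt)
    (integrable_rsKernel_line s hc₁ hd₁0 hd₁) (integrable_rsKernel_line s hc₂ hd₂0 hd₂)
    (decay_rsKernel s hc₁)
  simp only [rsLineIntegral]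
  rw [h]

/-! ## Reflection through the origin and the line through `0` -/

/-- `log(−x) = log x − πi` for `im x > 0`. [folklore] -/
lemma log_neg_of_im_pos {x : ℂ} (hx : 0 < x.im) : Complex.log (-x) = Complex.log x - π * I := by
  apply Complex.ext
  · simp [Complex.log_re, norm_neg]
  · simp [Complex.log_im, Complex.arg_neg_eq_arg_sub_pi_of_im_pos hx]

/-- `(−x)^w = x^w e^{−πiw}` for `im x > 0` (principal branch). [folklore] -/
lemma neg_cpow_of_im_pos {x : ℂ} (hx : 0 < x.im) (w : ℂ) :
    (-x) ^ w = x ^ w * cexp (-(π * I * w)) := by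
  have hx0 : x ≠ 0 := fun h ↦ by rw [h] at hx; simp at hx
  have hnx0 : -x ≠ 0 := neg_ne_zero.2 hx0
  rw [cpow_def_of_ne_zero hnx0, cpow_def_of_ne_zero hx0, ← Complex.exp_add, log_neg_of_im_pos hx]
  congr 1
  ring

/-- **Reflection**: `F_s(−x) = −e^{πis} F_s(x)` for `im x > 0`. [folklore] -/
lemma rsKernel_neg {s x : ℂ} (hx : 0 < x.im) :
    rsKernel s (-x) = -cexp (π * I * s) * rsKernel s x := by
  have h1 : (-x) ^ (-s) = x ^ (-s) * cexp (π * I * s) := by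
    rw [neg_cpow_of_im_pos hx, show -(↑π * I * -s) = (π : ℂ) * I * s by ring]
  have h2 : Complex.sin (π * -x) = -Complex.sin (π * x) := by
    rw [show (π : ℂ) * -x = -(π * x) by ring, Complex.sin_neg]
  simp only [rsKernel, neg_sq, h1, h2]
  rw [show (2 : ℂ) * I * -Complex.sin (π * x) = -(2 * I * Complex.sin (π * x)) by ring, div_neg]
  ring

/-- Near the origin the kernel is `O(‖z‖^{−σ−1})`: for `‖z‖ ≤ 1/8`,
`‖F_s(z)‖ ≤ (e · e^{π|t|}/π) ‖z‖^{−σ−1}` (`‖sin w‖ ≥ ‖w‖/2` for `‖w‖ ≤ 1/2`). [folklore] -/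
lemma norm_sin_ge_half_norm {w : ℂ} (hw : ‖w‖ ≤ 1 / 2) : ‖w‖ / 2 ≤ ‖Complex.sin w‖ := by
  have hwI : ‖w * I‖ ≤ 1 := by rw [norm_mul, Complex.norm_I, mul_one]; linarith
  have hwI' : ‖-(w * I)‖ ≤ 1 := by rwa [norm_neg]
  have hsin : Complex.sin w - w =
      ((cexp (-(w * I)) - 1 - (-(w * I))) - (cexp (w * I) - 1 - w * I)) * I / 2 := by
    rw [Complex.sin]
    have : I * I = -1 := I_mul_I
    rw [show -w * I = -(w * I) by ring]
    field_simp
    linear_combination (-2 * w) * this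
  have h1 := Complex.norm_exp_sub_one_sub_id_le hwI'
  have h2 := Complex.norm_exp_sub_one_sub_id_le hwI
  rw [norm_neg] at h1
  have hwI2 : ‖w * I‖ = ‖w‖ := by rw [norm_mul, Complex.norm_I, mul_one]
  rw [hwI2] at h1 h2
  have h3 : ‖Complex.sin w - w‖ ≤ ‖w‖ ^ 2 := by
    rw [hsin, norm_div, norm_mul, Complex.norm_I, mul_one, Complex.norm_two]
    calc ‖(cexp (-(w * I)) - 1 - -(w * I)) - (cexp (w * I) - 1 - w * I)‖ / 2
        ≤ (‖cexp (-(w * I)) - 1 - -(w * I)‖ + ‖cexp (w * I) - 1 - w * I‖) / 2 := by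
          gcongr; exact norm_sub_le _ _
      _ ≤ (‖w‖ ^ 2 + ‖w‖ ^ 2) / 2 := by gcongr
      _ = ‖w‖ ^ 2 := by ring
  have h4 : ‖w‖ - ‖Complex.sin w‖ ≤ ‖w‖ ^ 2 := by
    have := norm_sub_norm_le w (Complex.sin w)
    rw [← norm_neg (w - Complex.sin w), neg_sub] at this
    linarith
  nlinarith [norm_nonneg w]

/-- Near the origin: `‖F_s(z)‖ ≤ (e^{1+π|t|}/π) ‖z‖^{−σ−1}` for `0 < ‖z‖ ≤ 1/8`. [folklore] -/
lemma norm_rsKernel_le_near_zero (s : ℂ) {z : ℂ} (hz0 : z ≠ 0) (hz : ‖z‖ ≤ 1 / 8) :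
    ‖rsKernel s z‖ ≤ Real.exp (1 + π * |s.im|) / π * ‖z‖ ^ (-s.re - 1) := by
  have hπ := Real.pi_pos
  have hπ4 := Real.pi_lt_four
  have hzpos : 0 < ‖z‖ := norm_pos_iff.2 hz0
  have hw : ‖(π : ℂ) * z‖ ≤ 1 / 2 := by
    rw [norm_mul, Complex.norm_real, Real.norm_eq_abs, abs_of_pos hπ]; nlinarith
  have hsin := norm_sin_ge_half_norm hw
  rw [norm_mul, Complex.norm_real, Real.norm_eq_abs, abs_of_pos hπ] at hsin
  have hsin0 : 0 < ‖Complex.sin (π * z)‖ := lt_of_lt_of_le (by positivity) hsin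
  rw [rsKernel, norm_div, norm_mul, norm_mul, norm_mul, Complex.norm_two, Complex.norm_I, mul_one,
    div_le_iff₀ (by positivity)]
  have h1 := norm_cpow_neg_le hz0 s
  have h2 : ‖cexp (π * I * z ^ 2)‖ ≤ Real.exp 1 := by
    rw [Complex.norm_exp]
    refine Real.exp_le_exp.2 ?_
    calc ((π : ℂ) * I * z ^ 2).re ≤ ‖(π : ℂ) * I * z ^ 2‖ := Complex.re_le_norm _
      _ = π * ‖z‖ ^ 2 := by
          rw [norm_mul, norm_mul, Complex.norm_real, Complex.norm_I, norm_pow, Real.norm_eq_abs,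
            abs_of_pos hπ, mul_one]
      _ ≤ 1 := by nlinarith
  have hr : ‖z‖ ^ (-s.re) = ‖z‖ ^ (-s.re - 1) * ‖z‖ := by
    rw [← Real.rpow_add_one hzpos.ne', sub_add_cancel]
  calc ‖z ^ (-s)‖ * ‖cexp (↑π * I * z ^ 2)‖
      ≤ (‖z‖ ^ (-s.re) * Real.exp (π * |s.im|)) * Real.exp 1 :=
        mul_le_mul h1 h2 (norm_nonneg _) (by positivity)
    _ = Real.exp (1 + π * |s.im|) / π * ‖z‖ ^ (-s.re - 1) * (2 * (π * ‖z‖ / 2)) := by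
        rw [hr, Real.exp_add]; field_simp
    _ ≤ Real.exp (1 + π * |s.im|) / π * ‖z‖ ^ (-s.re - 1) * (2 * ‖Complex.sin (↑π * z)‖) := by
        have : 0 ≤ Real.exp (1 + π * |s.im|) / π * ‖z‖ ^ (-s.re - 1) := by positivity
        gcongr

/-- For `σ < −1` the kernel is continuous at the origin (where it vanishes). [folklore] -/
lemma continuousAt_rsKernel_zero {s : ℂ} (hs : s.re < -1) : ContinuousAt (rsKernel s) 0 := by
  rw [ContinuousAt, rsKernel_zero]
  refine squeeze_zero_norm' (a := fun z ↦ Real.exp (1 + π * |s.im|) / π * ‖z‖ ^ (-s.re - 1)) ?_ ?_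
  · filter_upwards [Metric.ball_mem_nhds (0 : ℂ) (by norm_num : (0:ℝ) < 1 / 8)] with z hz
    rw [Metric.mem_ball, dist_zero_right] at hz
    by_cases h0 : z = 0
    · rw [h0, rsKernel_zero, norm_zero]; positivity
    · exact norm_rsKernel_le_near_zero s h0 hz.le
  · have hp : 0 < -s.re - 1 := by linarith
    have hc : Continuous fun z : ℂ ↦ Real.exp (1 + π * |s.im|) / π * ‖z‖ ^ (-s.re - 1) :=
      continuous_const.mul ((continuous_norm).rpow_const fun _ ↦ Or.inr hp.le)
    have := hc.continuousAt (x := (0 : ℂ))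
    rw [ContinuousAt, norm_zero, Real.zero_rpow hp.ne', mul_zero] at this
    exact this

/-- For `σ < −1`: continuity of the kernel on the closed strip `{0 ≤ re − im ≤ c}`, `c < 1`,
including at the origin. [folklore] -/
lemma continuousOn_rsKernel_strip_zero {s : ℂ} (hs : s.re < -1) {c : ℝ} (hc1 : c < 1) :
    ContinuousOn (rsKernel s) {z : ℂ | z.re - z.im ∈ Icc 0 c} := by
  intro z hz
  by_cases h0 : z = 0
  · rw [h0]; exact (continuousAt_rsKernel_zero hs).continuousWithinAt
  · refine (differentiableAt_rsKernel s (mem_slitPlane_of_re_sub_im hz.1 h0) ?_).continuousAt.continuousWithinAt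
    intro hsin
    obtain ⟨n, hn, hn'⟩ := eq_int_of_sin_eq_zero hsin
    rw [Set.mem_setOf_eq, hn'] at hz
    have h1 : (0 : ℝ) ≤ n := hz.1
    have h2 : (n : ℝ) < 1 := lt_of_le_of_lt hz.2 hc1
    have h3 : n = 0 := by
      have : (0 : ℤ) ≤ n := by exact_mod_cast h1
      have : n < 1 := by exact_mod_cast h2
      omega
    rw [h3] at hn; simp at hn; exact h0 hn

/-- Pointwise bound on the line through the origin, `σ < −1`, `N ≥ −σ − 1`:
`‖F_s(u(1+i))‖ ≤ (2^N e^{π|t|}/π) (1+|u|)^N e^{−2πu²}`. [folklore] -/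
lemma norm_rsKernel_line_zero_le {s : ℂ} (hs : s.re < -1) {N : ℕ} (hN : -s.re - 1 ≤ N) (u : ℝ) :
    ‖rsKernel s (line 0 u)‖ ≤ (2 : ℝ) ^ N * Real.exp (π * |s.im|) / π *
      ((1 + |u|) ^ N * Real.exp (-2 * π * u ^ 2 + 0 * u + 0)) := by
  have hπ := Real.pi_pos
  by_cases hu : u = 0
  · rw [hu]
    have : line 0 0 = 0 := by simp [line]
    rw [this, rsKernel_zero, norm_zero]
    positivity
  have hx0 : line 0 u ≠ 0 := by
    intro h; apply hu; have := congrArg Complex.im h; simpa using this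
  have hxnorm : ‖line 0 u‖ ≤ 2 * |u| := by simpa using norm_line_le 0 u
  have hxpos : 0 < ‖line 0 u‖ := norm_pos_iff.2 hx0
  have hupos : 0 < |u| := abs_pos.2 hu
  -- the denominator: `‖sin(π x)‖ ≥ π |u|`
  have hsq : ‖Complex.sin (π * line 0 u)‖ ^ 2 = Real.sin (π * u) ^ 2 + Real.sinh (π * u) ^ 2 := by
    rw [show (π : ℂ) * line 0 u = ((π * u : ℝ) : ℂ) + ((π * u : ℝ) : ℂ) * I by
      rw [line_eq]; push_cast; ring]
    exact sq_norm_sin_ofReal_add_mul_I _ _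
  have hsinh : π * |u| ≤ |Real.sinh (π * u)| := by
    rw [Real.abs_sinh, ← abs_of_pos hπ, ← abs_mul, abs_of_pos hπ]
    exact Real.self_le_sinh_iff.2 (by positivity)
  have hden : π * |u| ≤ ‖Complex.sin (π * line 0 u)‖ := by
    have key : (π * |u|) ^ 2 ≤ ‖Complex.sin (π * line 0 u)‖ ^ 2 := by
      have h5 : (π * |u|) ^ 2 ≤ |Real.sinh (π * u)| ^ 2 := pow_le_pow_left₀ (by positivity) hsinh 2
      rw [sq_abs] at h5
      rw [hsq]; nlinarith [sq_nonneg (Real.sin (π * u))]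
    have h := Real.sqrt_le_sqrt key
    rwa [Real.sqrt_sq (by positivity), Real.sqrt_sq (norm_nonneg _)] at h
  have hsinpos : 0 < ‖Complex.sin (π * line 0 u)‖ := lt_of_lt_of_le (by positivity) hden
  rw [rsKernel, norm_div, norm_mul, norm_mul, norm_mul, Complex.norm_two, Complex.norm_I, mul_one,
    div_le_iff₀ (by positivity)]
  have h1 := norm_cpow_neg_le hx0 s
  have h2 : ‖cexp (π * I * (line 0 u) ^ 2)‖ = Real.exp (-2 * π * u ^ 2 + 0 * u + 0) := by
    have := norm_cexp_quadPhase 0 0 u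
    simp only [zero_mul, add_zero, zero_re, zero_im, sub_zero, mul_zero] at this
    rw [this]; congr 1; ring
  have hp : 0 < -s.re - 1 := by linarith
  -- `‖x‖^{-σ} ≤ (2|u|)^{-σ} = (2|u|)^{-σ-1} (2|u|) ≤ 2^N (1+|u|)^N (2|u|)`
  have h3 : ‖line 0 u‖ ^ (-s.re) ≤ (2 : ℝ) ^ N * (1 + |u|) ^ N * (2 * |u|) := by
    have e1 : ‖line 0 u‖ ^ (-s.re) ≤ (2 * |u|) ^ (-s.re) :=
      Real.rpow_le_rpow (norm_nonneg _) hxnorm (by linarith)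
    have e2 : (2 * |u|) ^ (-s.re) = (2 * |u|) ^ (-s.re - 1) * (2 * |u|) := by
      rw [← Real.rpow_add_one (by positivity : (2 * |u| : ℝ) ≠ 0), sub_add_cancel]
    have e3 : (2 * |u|) ^ (-s.re - 1) ≤ (2 * (1 + |u|)) ^ (-s.re - 1) :=
      Real.rpow_le_rpow (by positivity) (by linarith) hp.le
    have e4 : (2 * (1 + |u|)) ^ (-s.re - 1) ≤ (2 * (1 + |u|)) ^ (N : ℝ) :=
      Real.rpow_le_rpow_of_exponent_le (by linarith) hN
    rw [Real.rpow_natCast, mul_pow] at e4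
    calc ‖line 0 u‖ ^ (-s.re) ≤ (2 * |u|) ^ (-s.re - 1) * (2 * |u|) := by rw [← e2]; exact e1
      _ ≤ (2 : ℝ) ^ N * (1 + |u|) ^ N * (2 * |u|) := by
          exact mul_le_mul_of_nonneg_right (e3.trans e4) (by positivity)
  set E := Real.exp (-2 * π * u ^ 2 + 0 * u + 0) with hE
  calc ‖line 0 u ^ (-s)‖ * ‖cexp (↑π * I * line 0 u ^ 2)‖
      ≤ (‖line 0 u‖ ^ (-s.re) * Real.exp (π * |s.im|)) * E := by
        rw [h2]; exact mul_le_mul_of_nonneg_right h1 (Real.exp_pos _).le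
    _ ≤ ((2 : ℝ) ^ N * (1 + |u|) ^ N * (2 * |u|) * Real.exp (π * |s.im|)) * E := by gcongr
    _ = (2 : ℝ) ^ N * Real.exp (π * |s.im|) / π * ((1 + |u|) ^ N * E) * (2 * (π * |u|)) := by
        field_simp
    _ ≤ (2 : ℝ) ^ N * Real.exp (π * |s.im|) / π * ((1 + |u|) ^ N * E) *
          (2 * ‖Complex.sin (↑π * line 0 u)‖) := by
        have : 0 ≤ (2 : ℝ) ^ N * Real.exp (π * |s.im|) / π * ((1 + |u|) ^ N * E) := by positivity
        gcongr

/-- Integrability of the kernel along the line through the origin, `σ < −1`. [folklore] -/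
theorem integrable_rsKernel_line_zero {s : ℂ} (hs : s.re < -1) :
    Integrable fun u : ℝ ↦ rsKernel s (line 0 u) := by
  set N : ℕ := ⌈-s.re - 1⌉₊ with hN
  have hN' : -s.re - 1 ≤ N := Nat.le_ceil _
  have hcont : Continuous fun u : ℝ ↦ rsKernel s (line 0 u) := by
    have h1 : ContinuousOn (rsKernel s) {z : ℂ | z.re - z.im ∈ Icc 0 (1 / 2)} :=
      continuousOn_rsKernel_strip_zero hs (by norm_num)
    refine h1.comp_continuous (by fun_prop : Continuous fun u : ℝ ↦ line 0 u) fun u ↦ ?_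
    simp
  exact Integrable.mono' ((integrable_poly_mul_gaussian N 0 0).const_mul
    ((2 : ℝ) ^ N * Real.exp (π * |s.im|) / π)) hcont.aestronglyMeasurable
    (Eventually.of_forall fun u ↦ norm_rsKernel_line_zero_le hs hN' u)

/-- **Pushing the line onto the origin** (`σ < −1`, `0 < c < 1`): `J_c(s) = J_0(s)`, where
`J_0` is the (absolutely convergent) integral over the line of slope one through `0`.
[cite: Siegel1932, §3] -/
theorem rsLineIntegral_eq_zero_line {s : ℂ} (hs : s.re < -1) {c : ℝ} (hc0 : 0 < c)
    (hc1 : c < 1) : rsLineIntegral c s = rsLineIntegral 0 s := by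
  set N : ℕ := ⌈-s.re⌉₊ with hN
  have hN' : |s.re| ≤ N := by
    rw [abs_of_neg (by linarith)]; exact Nat.le_ceil _
  have hcn : ∀ n : ℤ, (n : ℝ) ≠ c := by
    intro n h
    have h1 : (0 : ℝ) < n := h ▸ hc0
    have h2 : (n : ℝ) < 1 := h ▸ hc1
    have : (0 : ℤ) < n := by exact_mod_cast h1
    have : n < 1 := by exact_mod_cast h2
    omega
  obtain ⟨d, hd0, hd⟩ := exists_pos_le_abs_sub_int hcn
  -- decay on cross-sections `c' ∈ [0, c]`
  have hG : ∀ c' ∈ Icc 0 c, ∀ T : ℝ, 1 ≤ |T| →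
      ‖(line c' T) ^ (-s) * (2 * I)⁻¹‖ ≤ ((2 : ℝ) ^ N * Real.exp (π * |s.im|) / 2) * (1 + |T|) ^ N := by
    intro c' hc' T hT
    have hT0 : line c' T ≠ 0 := by
      intro h
      have him := congrArg Complex.im h
      simp only [line_im, Complex.zero_im] at him
      rw [him, abs_zero] at hT
      linarith
    have h1 := norm_cpow_neg_le hT0 s
    have hxn : ‖line c' T‖ ≤ 2 * (1 + |T|) := by
      have := norm_line_le c' T
      rw [abs_of_nonneg hc'.1] at this
      linarith [hc'.2]
    have h2 : ‖line c' T‖ ^ (-s.re) ≤ (2 * (1 + |T|)) ^ (N : ℝ) :=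
      (Real.rpow_le_rpow (norm_nonneg _) hxn (by linarith)).trans
        (Real.rpow_le_rpow_of_exponent_le (by linarith [abs_nonneg T]) (le_trans (le_abs_self _)
          (by rw [abs_neg]; exact hN')))
    rw [Real.rpow_natCast, mul_pow] at h2
    rw [norm_mul, norm_inv, norm_mul, Complex.norm_two, Complex.norm_I, mul_one]
    have h12 : ‖line c' T ^ (-s)‖ ≤ (2 : ℝ) ^ N * (1 + |T|) ^ N * Real.exp (π * |s.im|) :=
      h1.trans (mul_le_mul_of_nonneg_right h2 (Real.exp_pos _).le)
    calc ‖line c' T ^ (-s)‖ * 2⁻¹ ≤ ((2 : ℝ) ^ N * (1 + |T|) ^ N * Real.exp (π * |s.im|)) * 2⁻¹ :=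
          mul_le_mul_of_nonneg_right h12 (by norm_num)
      _ = (2 : ℝ) ^ N * Real.exp (π * |s.im|) / 2 * (1 + |T|) ^ N := by ring
  have hdecay := decay_mul_cexp_quadPhase_div_sin (G := fun x : ℂ ↦ x ^ (-s) * (2 * I)⁻¹) hG 0
  have hdecay' : ∀ ε : ℝ, 0 < ε → ∃ T₀ : ℝ, ∀ T : ℝ, T₀ ≤ |T| → ∀ c' ∈ Icc 0 c,
      ‖rsKernel s (line c' T)‖ ≤ ε := by
    intro ε hε
    obtain ⟨T₀, hT₀⟩ := hdecay ε hε
    refine ⟨T₀, fun T hT c' hc' ↦ ?_⟩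
    have h1 := hT₀ T hT c' hc'
    rwa [← rsKernel_eq] at h1
  have hcont := continuousOn_rsKernel_strip_zero hs hc1
  have hdiff : DifferentiableOn ℂ (rsKernel s) {z : ℂ | z.re - z.im ∈ Ioo 0 c} := by
    intro z hz
    refine (differentiableAt_rsKernel s (mem_slitPlane_of_re_sub_im hz.1.le ?_) ?_).differentiableWithinAt
    · intro h0; rw [h0] at hz; simp at hz
    · intro hsin
      obtain ⟨n, -, hn'⟩ := eq_int_of_sin_eq_zero hsin
      rw [Set.mem_setOf_eq, hn'] at hz
      have h1 : (0 : ℝ) < n := hz.1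
      have h2 : (n : ℝ) < 1 := lt_trans hz.2 hc1
      have : (0 : ℤ) < n := by exact_mod_cast h1
      have : n < 1 := by exact_mod_cast h2
      omega
  have h := Literature.Analysis.Complex.integral_slant_eq_of_continuousOn_of_differentiableOn
    (f := rsKernel s) hc0.le hcont hdiff (integrable_rsKernel_line_zero hs)
    (integrable_rsKernel_line s hc0 hd0 hd) hdecay'
  simp only [rsLineIntegral]
  rw [h]

/-- **The line through the origin splits into two rays** (`σ < −1`):
`∫_ℝ F_s(u(1+i)) du = (1 − e^{πis}) ∫_0^∞ F_s(u(1+i)) du` (reflection `F_s(−x) = −e^{πis}F_s(x)`).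
[cite: Siegel1932, §3] -/
theorem integral_rsKernel_line_zero {s : ℂ} (hs : s.re < -1) :
    ∫ u : ℝ, rsKernel s (line 0 u) =
      (1 - cexp (π * I * s)) * ∫ u in Ioi (0 : ℝ), rsKernel s (line 0 u) := by
  have hint := integrable_rsKernel_line_zero hs
  rw [← intervalIntegral.integral_Iic_add_Ioi hint.integrableOn hint.integrableOn, sub_mul, one_mul]
  have hneg : ∫ u in Iic (0 : ℝ), rsKernel s (line 0 u) =
      ∫ u in Ioi (0 : ℝ), rsKernel s (line 0 (-u)) := by
    rw [integral_comp_neg_Ioi 0 (fun u ↦ rsKernel s (line 0 u)), neg_zero]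
  have hrefl : ∫ u in Ioi (0 : ℝ), rsKernel s (line 0 (-u)) =
      -cexp (π * I * s) * ∫ u in Ioi (0 : ℝ), rsKernel s (line 0 u) := by
    rw [← MeasureTheory.integral_const_mul]
    refine setIntegral_congr_fun measurableSet_Ioi fun u hu ↦ ?_
    have hx : line 0 (-u) = -(line 0 u) := by simp only [line]; push_cast; ring
    rw [hx, rsKernel_neg (by simpa using hu)]
  rw [hneg, hrefl]
  ring

/-! ## Analyticity in `s` -/

/-- **Riemann's line integrals are entire functions of `s`** (`c > 0` non-integer):
holomorphic dependence of a dominated parameter integral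
(`Literature.Analysis.Complex.differentiableOn_integral_of_dominated`), the majorant on the ball
`‖s − s₀‖ < 1` being the Gaussian bound `norm_rsKernel_line_le` with `N = ⌈|σ₀|⌉ + 1`,
`|t| ≤ |t₀| + 1`. [cite: Siegel1932, §3] -/
theorem differentiable_rsLineIntegral {c : ℝ} (hc : 0 < c) (hcn : ∀ n : ℤ, (n : ℝ) ≠ c) :
    Differentiable ℂ (rsLineIntegral c) := by
  obtain ⟨d, hd0, hd⟩ := exists_pos_le_abs_sub_int hcn
  have hmain : DifferentiableOn ℂ (fun s : ℂ ↦ ∫ u : ℝ, rsKernel s (line c u)) univ := by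
    refine Literature.Analysis.Complex.differentiableOn_integral_of_dominated (μ := volume)
      (F := fun (s : ℂ) (u : ℝ) ↦ rsKernel s (line c u)) (fun s _ ↦
        (continuous_rsKernel_line s hc hcn).aestronglyMeasurable) ?_ ?_
    · refine Eventually.of_forall fun u ↦ ?_
      have hx0 : line c u ≠ 0 := line_ne_zero hc.ne' u
      intro s _
      have h1 : DifferentiableAt ℂ (fun p : ℂ ↦ (line c u) ^ (-p)) s :=
        differentiableAt_id.neg.const_cpow (Or.inl hx0)
      exact ((h1.mul_const _).div_const _).differentiableWithinAt
    · intro s₀ _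
      set N : ℕ := ⌈|s₀.re|⌉₊ + 1 with hN
      set τ : ℝ := |s₀.im| + 1 with hτ
      refine ⟨1, one_pos, subset_univ _, fun u ↦ (|c| + 2 / |c| + 2) ^ N * Real.exp (π * τ) / (2 * d) *
        ((1 + |u|) ^ N * Real.exp (-2 * π * u ^ 2 + (-2 * π * c) * u + 0)), ?_, ?_⟩
      · exact (integrable_poly_mul_gaussian N (-2 * π * c) 0).const_mul _
      · refine Eventually.of_forall fun u s hs ↦ ?_
        dsimp only
        rw [Metric.mem_ball] at hs
        have hre : |s.re| ≤ N := by
          have h1 : |s.re - s₀.re| ≤ ‖s - s₀‖ := by simpa using abs_re_le_norm (s - s₀)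
          have h2 : |s.re| ≤ |s₀.re| + 1 := by
            have := abs_sub_abs_le_abs_sub s.re s₀.re
            rw [dist_eq_norm] at hs; linarith
          have h3 : (|s₀.re| : ℝ) ≤ ⌈|s₀.re|⌉₊ := Nat.le_ceil _
          rw [hN]; push_cast; linarith
        have him : |s.im| ≤ τ := by
          have h1 : |s.im - s₀.im| ≤ ‖s - s₀‖ := by simpa using abs_im_le_norm (s - s₀)
          have := abs_sub_abs_le_abs_sub s.im s₀.im
          rw [dist_eq_norm] at hs; rw [hτ]; linarith
        refine (norm_rsKernel_line_le hc hd0 hd u s hre).trans ?_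
        have hexp : Real.exp (π * |s.im|) ≤ Real.exp (π * τ) :=
          Real.exp_le_exp.2 (mul_le_mul_of_nonneg_left him Real.pi_pos.le)
        gcongr
  have h2 : Differentiable ℂ (fun s : ℂ ↦ ∫ u : ℝ, rsKernel s (line c u)) :=
    differentiableOn_univ.1 hmain
  have h3 : rsLineIntegral c = fun s ↦ -(1 + I) * ∫ u : ℝ, rsKernel s (line c u) := rfl
  rw [h3]
  exact h2.const_mul _

/-- **Riemann's auxiliary function `𝓡(s)` is entire.** [cite: Siegel1932, §3 eq. (58)] -/
theorem differentiable_riemannAux : Differentiable ℂ riemannAux :=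
  differentiable_rsLineIntegral (c := 1 / 2) (by norm_num) int_ne_half


end SiegelIntegral

end Literature.NumberTheory.LFunctions
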